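import Literature.Computability.AlgebraicComplexity.ConstituentStageCounts
import HarnessLib

/-!
# Realising the data of one region of the constituent stage: a consistent reference triple exists
(Vassilevska Williams–Xu–Xu–Zhou 2024, §6.2: "block triples that are consistent with `{α_t}`") — proved

Topic `Literature/Computability/AlgebraicComplexity`.  The one-region theorems of the constituent stage
(`ConstituentStageAssembly.vxxz2024_prop62_region`, `ConstituentStageEpsilon.vxxz2024_thm63_region`, …)
take a reference triple `T₀ ∈ D.consistent` — a remaining level-`(ℓ−1)` block triple whose left split
types on the chunks of every term `t` have the prescribed counts `cnt t` (`= α_t(i',j',k') · n_t`,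
§6.2 of Vassilevska Williams–Xu–Xu–Zhou, *New bounds for matrix multiplication: from alpha to omega*,
SODA 2024, arXiv:2307.07970).  For data read off NUMERICAL parameters (the certificate of §8) such a
triple has to be CONSTRUCTED.  This file proves its existence under the natural validity conditions:

* `inducedCountsX/Y/Z` — the pair counts `k_X, k_Y, k_Z` induced by the left-type counts `cnt`
  (`k_X t (l, r) = [r = i_t − l] · ∑_{a : a₁ = l} cnt t a`: the remaining `X`-blocks are those with the
  one-level split `γ̃_{X,t}` induced by `α_t`, Prop. 6.2);
* `ofLeftWord_mem_consistent` — for counts supported on constituent triples inside the box of the term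
  with constituent complements, the triple of ANY word with these counts is consistent, for the
  region whose pair counts are the induced ones;
* `consistent_nonempty` — **a consistent triple exists** as soon as, in addition, the counts of every
  term sum to its number of chunks (a word with prescribed counts exists, `MultiTypeClassCount`);
* `isLevelTriple_of_mem_consistent` — and it is a level triple (`tripleSet_good`).

Everything is proved; the definitions are the three induced count tables; no named facts.

## References

* V. Vassilevska Williams, Y. Xu, Z. Xu, R. Zhou, *New bounds for matrix multiplication: from alpha
  to omega*, SODA 2024, arXiv:2307.07970 (held: `paper:arxiv-2307.07970`), §6 (preamble), §6.2
  (numalpha), Prop. 6.2 (γ̃_{X,t}). [VassilevskaWilliamsXuXuZhou2024]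
-/

noncomputable section

open scoped BigOperators
open Finset

namespace Literature.Computability.AlgebraicComplexity

universe u

/-! ## The pair counts induced by the left-type counts -/

section Induced

variable {c s : ℕ} (L : Fin s → InterfaceTerm (c + c)) (cnt : Fin s → Fin (2 * c + 1) × Fin (2 * c + 1) × Fin (2 * c + 1) → ℕ)

/-- **`k_X` induced by the left-type counts**: `k_X t (l, r) = [r = i_t − l] · ∑_{a : a₁ = l} cnt t a`.
[cite: VassilevskaWilliamsXuXuZhou2024, Prop. 6.2 (γ̃_{X,t}(l, i_t − l) = ∑_{j',k'} α_t(l, j', k'))] -/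
def inducedCountsX (t : Fin s) (lr : Fin (2 * c + 1) × Fin (2 * c + 1)) : ℕ :=
  if (lr.2 : ℕ) = (L t).i - lr.1 then ∑ a ∈ univ.filter (fun a : Fin (2 * c + 1) × Fin (2 * c + 1) × Fin (2 * c + 1) => a.1 = lr.1), cnt t a else 0

/-- `k_Y` induced by the left-type counts. [cite: VassilevskaWilliamsXuXuZhou2024, Prop. 6.2 (γ̃_{Y,t})] -/
def inducedCountsY (t : Fin s) (lr : Fin (2 * c + 1) × Fin (2 * c + 1)) : ℕ :=
  if (lr.2 : ℕ) = (L t).j - lr.1 then ∑ a ∈ univ.filter (fun a : Fin (2 * c + 1) × Fin (2 * c + 1) × Fin (2 * c + 1) => a.2.1 = lr.1), cnt t a else 0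

/-- `k_Z` induced by the left-type counts. [cite: VassilevskaWilliamsXuXuZhou2024, Prop. 6.2 (γ̃_{Z,t})] -/
def inducedCountsZ (t : Fin s) (lr : Fin (2 * c + 1) × Fin (2 * c + 1)) : ℕ :=
  if (lr.2 : ℕ) = (L t).k - lr.1 then ∑ a ∈ univ.filter (fun a : Fin (2 * c + 1) × Fin (2 * c + 1) × Fin (2 * c + 1) => a.2.2 = lr.1), cnt t a else 0

end Induced

/-! ## The triple of a word with valid counts is consistent -/

namespace ConstituentRegion

open scoped Classical

variable {c n s M : ℕ} {D : ConstituentRegion c n s M}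

/-- **Validity of the left-type counts**: `cnt t` vanishes outside `{0,…,2c}³`, and every counted left
type `a = (i',j',k')` of term `t` is a level-`(ℓ−1)` constituent triple inside the box `(i_t, j_t, k_t)`
whose complement is constituent. [cite: VassilevskaWilliamsXuXuZhou2024, Prop. 6.2 ("i' + j' + k' = 2^{ℓ−1}, 0 ≤ i' ≤ i_t, 0 ≤ j' ≤ j_t, 0 ≤ k' ≤ k_t")] -/
structure CountsValid (D : ConstituentRegion c n s M) : Prop where
  /-- out of range the counts vanish -/
  range : ∀ t ijk, ¬ (ijk.1 ≤ 2 * c ∧ ijk.2.1 ≤ 2 * c ∧ ijk.2.2 ≤ 2 * c) → D.cnt t ijk = 0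
  /-- counted left types are constituent, in the box, with constituent complements -/
  good : ∀ t a, D.leftCounts t a ≠ 0 →
    (a.1 : ℕ) ≤ (D.L t).i ∧ (a.2.1 : ℕ) ≤ (D.L t).j ∧ (a.2.2 : ℕ) ≤ (D.L t).k ∧
      (D.L t).i - a.1 ≤ 2 * c ∧ (D.L t).j - a.2.1 ≤ 2 * c ∧ (D.L t).k - a.2.2 ≤ 2 * c ∧
      (a.1 : ℕ) + a.2.1 + a.2.2 = 2 * c ∧ ((D.L t).i - a.1) + ((D.L t).j - a.2.1) + ((D.L t).k - a.2.2) = 2 * c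

/-- A letter of a word with the counts occurs with non-zero count in its term. [folklore] -/
theorem leftCounts_ne_zero_of_mem {w : Fin n → Fin (2 * c + 1) × Fin (2 * c + 1) × Fin (2 * c + 1)}
    (hw : w ∈ multiTypeClass D.τ D.leftCounts) (u : Fin n) : D.leftCounts (D.τ u) (w u) ≠ 0 := by
  rw [← (mem_multiTypeClass.1 hw) (D.τ u) (w u), countOn_apply]
  exact (card_pos.2 ⟨u, by simp⟩).ne'

/-- **The triple of a word with valid counts is consistent** (for the region whose pair counts are the
induced ones). [cite: VassilevskaWilliamsXuXuZhou2024, §6.2 (consistent triples) and §6 (preamble)] -/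
theorem ofLeftWord_mem_consistent (hV : D.CountsValid)
    (hkX : D.kX = inducedCountsX D.L D.leftCounts) (hkY : D.kY = inducedCountsY D.L D.leftCounts) (hkZ : D.kZ = inducedCountsZ D.L D.leftCounts)
    {w : Fin n → Fin (2 * c + 1) × Fin (2 * c + 1) × Fin (2 * c + 1)} (hw : w ∈ multiTypeClass D.τ D.leftCounts) :
    D.ofLeftWord w ∈ D.consistent := by
  have hgood : ∀ u, ((w u).1 : ℕ) ≤ (D.L (D.τ u)).i ∧ ((w u).2.1 : ℕ) ≤ (D.L (D.τ u)).j ∧ ((w u).2.2 : ℕ) ≤ (D.L (D.τ u)).k ∧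
      (D.L (D.τ u)).i - (w u).1 ≤ 2 * c ∧ (D.L (D.τ u)).j - (w u).2.1 ≤ 2 * c ∧ (D.L (D.τ u)).k - (w u).2.2 ≤ 2 * c ∧
      ((w u).1 : ℕ) + (w u).2.1 + (w u).2.2 = 2 * c ∧
      ((D.L (D.τ u)).i - (w u).1) + ((D.L (D.τ u)).j - (w u).2.1) + ((D.L (D.τ u)).k - (w u).2.2) = 2 * c :=
    fun u => hV.good (D.τ u) (w u) (leftCounts_ne_zero_of_mem hw u)
  -- values of `ofLeftWord`
  have hvalL : ∀ u : Fin n, (D.ofLeftWord w).1 (Fin.castAdd n u) = (w u).1 ∧ (D.ofLeftWord w).2.1 (Fin.castAdd n u) = (w u).2.1 ∧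
      (D.ofLeftWord w).2.2 (Fin.castAdd n u) = (w u).2.2 := fun u => ⟨by simp [ofLeftWord], by simp [ofLeftWord], by simp [ofLeftWord]⟩
  have hvalR : ∀ u : Fin n, ((D.ofLeftWord w).1 (Fin.natAdd n u) : ℕ) = (D.L (D.τ u)).i - (w u).1 ∧
      ((D.ofLeftWord w).2.1 (Fin.natAdd n u) : ℕ) = (D.L (D.τ u)).j - (w u).2.1 ∧
        ((D.ofLeftWord w).2.2 (Fin.natAdd n u) : ℕ) = (D.L (D.τ u)).k - (w u).2.2 := by
    intro u
    obtain ⟨-, -, -, h4, h5, h6, -⟩ := hgood u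
    simp only [ofLeftWord, Fin.addCases_right]
    exact ⟨val_finSub_of_le h4, val_finSub_of_le h5, val_finSub_of_le h6⟩
  have hIw : InsideX D.τ D.L (D.ofLeftWord w).1 := fun u => by
    obtain ⟨h1, -, -⟩ := hgood u; rw [(hvalL u).1, (hvalR u).1]; omega
  have hJw : InsideY D.τ D.L (D.ofLeftWord w).2.1 := fun u => by
    obtain ⟨-, h2, -⟩ := hgood u; rw [(hvalL u).2.1, (hvalR u).2.1]; omega
  have hKw : InsideZ D.τ D.L (D.ofLeftWord w).2.2 := fun u => by
    obtain ⟨-, -, h3, -⟩ := hgood u; rw [(hvalL u).2.2, (hvalR u).2.2]; omega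
  have hleft : ∀ t a, countOn (classOf D.τ t) (leftWord (D.ofLeftWord w)) a = D.leftCounts t a := fun t a => by
    rw [leftWord_ofLeftWord, (mem_multiTypeClass.1 hw) t a]
  -- membership in the universe
  have hmemU : D.ofLeftWord w ∈ D.tripleSet := by
    rw [mem_tripleUniverse]
    refine ⟨⟨?_, ?_, ?_⟩, fun p => ?_⟩
    · rw [mem_pairTypeClass, mem_multiTypeClass]
      rintro t ⟨l, r⟩
      rw [countOn_halfPairs_of_inside hIw, card_filter_left_eq_sum, hkX, inducedCountsX]
      simp only [hleft]
    · rw [mem_pairTypeClass, mem_multiTypeClass]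
      rintro t ⟨l, r⟩
      have hJw' : InsideX D.τ (fun t => (D.L t).swapXY) (D.ofLeftWord w).2.1 := fun u => by simpa using hJw u
      rw [countOn_halfPairs_of_inside (D := { D with L := fun t => (D.L t).swapXY }) hJw', hkY, inducedCountsY]
      show (if (r : ℕ) = (D.L t).swapXY.i - l then ((classOf D.τ t).filter fun u => (D.ofLeftWord w).2.1 (Fin.castAdd n u) = l).card else 0) = _
      rw [card_filter_left_eq_sum₂]
      simp only [hleft, InterfaceTerm.swapXY_i]
    · rw [mem_pairTypeClass, mem_multiTypeClass]
      rintro t ⟨l, r⟩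
      have hKw' : InsideX D.τ (fun t => (D.L t).swapXZ) (D.ofLeftWord w).2.2 := fun u => by simpa using hKw u
      rw [countOn_halfPairs_of_inside (D := { D with L := fun t => (D.L t).swapXZ }) hKw', hkZ, inducedCountsZ]
      show (if (r : ℕ) = (D.L t).swapXZ.i - l then ((classOf D.τ t).filter fun u => (D.ofLeftWord w).2.2 (Fin.castAdd n u) = l).card else 0) = _
      rw [card_filter_left_eq_sum₃]
      simp only [hleft, InterfaceTerm.swapXZ_i]
    · refine Fin.addCases (motive := fun p => ((D.ofLeftWord w).1 p : ℕ) + (D.ofLeftWord w).2.1 p + (D.ofLeftWord w).2.2 p = 2 * c)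
        (fun u => ?_) (fun u => ?_) p
      · rw [(hvalL u).1, (hvalL u).2.1, (hvalL u).2.2]
        exact (hgood u).2.2.2.2.2.2.1
      · rw [(hvalR u).1, (hvalR u).2.1, (hvalR u).2.2]
        exact (hgood u).2.2.2.2.2.2.2
  -- consistency with `cnt`
  refine mem_filter.2 ⟨hmemU, fun t ijk => ?_⟩
  by_cases hsmall : ijk.1 ≤ 2 * c ∧ ijk.2.1 ≤ 2 * c ∧ ijk.2.2 ≤ 2 * c
  · have e := card_leftClass_eq_countOn (D := D) (D.ofLeftWord w) t (⟨ijk.1, by omega⟩, ⟨ijk.2.1, by omega⟩, ⟨ijk.2.2, by omega⟩)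
    simp only at e
    rw [e, hleft]
  · -- out of range: the class is empty and the count is zero
    have hempty : leftClass D.τ (seqVal (D.ofLeftWord w).1) (seqVal (D.ofLeftWord w).2.1) (seqVal (D.ofLeftWord w).2.2) t ijk.1 ijk.2.1 ijk.2.2 = ∅ := by
      rw [Finset.eq_empty_iff_forall_notMem]
      intro u hu
      rw [mem_leftClass] at hu
      obtain ⟨-, h1, h2, h3⟩ := hu
      simp only [seqVal] at h1 h2 h3
      have := ((D.ofLeftWord w).1 (Fin.castAdd n u)).isLt
      have := ((D.ofLeftWord w).2.1 (Fin.castAdd n u)).isLt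
      have := ((D.ofLeftWord w).2.2 (Fin.castAdd n u)).isLt
      omega
    rw [hempty, card_empty]
    exact (hV.range t ijk hsmall).symm

/-- **A consistent reference triple exists** when the counts are valid, the pair counts are the
induced ones, and the counts of every term sum to its number of chunks.
[cite: VassilevskaWilliamsXuXuZhou2024, §6.2 (block triples consistent with {α_t})] -/
theorem consistent_nonempty (hV : D.CountsValid)
    (hkX : D.kX = inducedCountsX D.L D.leftCounts) (hkY : D.kY = inducedCountsY D.L D.leftCounts) (hkZ : D.kZ = inducedCountsZ D.L D.leftCounts)
    (hsum : ∀ t, ∑ a, D.leftCounts t a = Fintype.card {u // D.τ u = t}) : D.consistent.Nonempty := by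
  have hne : (multiTypeClass D.τ D.leftCounts).Nonempty := by
    rw [← card_pos, card_multiTypeClass_eq_prod_multinomial D.τ D.leftCounts hsum]
    exact prod_pos fun t _ => Nat.multinomial_pos _ _
  obtain ⟨w, hw⟩ := hne
  exact ⟨D.ofLeftWord w, ofLeftWord_mem_consistent hV hkX hkY hkZ hw⟩

/-- A consistent triple is a level triple. [cite: VassilevskaWilliamsXuXuZhou2024, §6.2] -/
theorem isLevelTriple_of_mem_consistent (hD : D.WellFormed)
    {T : (Fin (n + n) → Fin (2 * c + 1)) × (Fin (n + n) → Fin (2 * c + 1)) × (Fin (n + n) → Fin (2 * c + 1))} (hT : T ∈ D.consistent) :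
    IsLevelTriple c (seqVal T.1) (seqVal T.2.1) (seqVal T.2.2) :=
  (tripleSet_good hD (filter_subset _ _ hT)).1

/-- **Well-formedness of the supports is automatic for induced pair counts** with valid counts
(Remark 5.2 for the targets remains a condition on `β`). [cite: VassilevskaWilliamsXuXuZhou2024, Prop. 6.2] -/
theorem wellFormed_of_induced (hV : D.CountsValid)
    (hkX : D.kX = inducedCountsX D.L D.leftCounts) (hkY : D.kY = inducedCountsY D.L D.leftCounts) (hkZ : D.kZ = inducedCountsZ D.L D.leftCounts)
    (hrevX : ∀ t i k σ, D.βZ t (i, 0, k) σ = D.βX t (i, 0, k) (fun r => (σ r).rev))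
    (hrevY : ∀ t j k σ, D.βZ t (0, j, k) σ = D.βY t (0, j, k) (fun r => (σ r).rev)) : D.WellFormed where
  suppX := by
    intro t lr hne
    rw [hkX, inducedCountsX] at hne
    split_ifs at hne with hr
    · obtain ⟨a, ha, hne'⟩ := exists_ne_zero_of_sum_ne_zero hne
      obtain ⟨h1, -⟩ := hV.good t a hne'
      rw [(mem_filter.1 ha).2] at h1
      omega
    · exact absurd rfl hne
  suppY := by
    intro t lr hne
    rw [hkY, inducedCountsY] at hne
    split_ifs at hne with hr
    · obtain ⟨a, ha, hne'⟩ := exists_ne_zero_of_sum_ne_zero hne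
      obtain ⟨-, h2, -⟩ := hV.good t a hne'
      rw [(mem_filter.1 ha).2] at h2
      omega
    · exact absurd rfl hne
  suppZ := by
    intro t lr hne
    rw [hkZ, inducedCountsZ] at hne
    split_ifs at hne with hr
    · obtain ⟨a, ha, hne'⟩ := exists_ne_zero_of_sum_ne_zero hne
      obtain ⟨-, -, h3, -⟩ := hV.good t a hne'
      rw [(mem_filter.1 ha).2] at h3
      omega
    · exact absurd rfl hne
  revX := hrevX
  revY := hrevY

end ConstituentRegion

end Literature.Computability.AlgebraicComplexity
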